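/-
Copyright (c) 2026. All rights reserved.
Released under Apache 2.0 license as described in the file LICENSE.
Authors: abc-iut cell, statement-typer seat abc-iut-L4-t3 (wave 1).
-/
import Mathlib.CategoryTheory.Endomorphism
import Literature.AnabelianGeometry.AbsoluteAnabelian.GaloisTheaters
import Literature.AnabelianGeometry.AbsoluteAnabelian.MonoAnalyticLogShells
import HarnessLib

/-!
# [AbsTopIII] Definition 5.1 (v), (vi), Corollary 5.2 (ii)–(iv), Remarks 5.2.2–5.2.3, Definition 5.4 (i): global and panalocal `T`-pairs

S. Mochizuki, *Topics in absolute anabelian geometry III: global reconstruction algorithms*,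
J. Math. Sci. Univ. Tokyo 22 (2015) 939–1156 [MochizukiAbsTopIII2015]; locators `p.N` = pages of the
author's manuscript (`paper:url-5493eb38cbb7`; journal pagination not held), read on the page: Def 5.1 (v)
pp. 116–117, (vi) p. 118; Cor 5.2 (ii)–(iv) pp. 119–120; Rmk 5.2.2, 5.2.3 p. 121; Def 5.4 (i) pp. 124–125.

## What is typed and how

`T ∈ {TF, TM, TLG}` (Def 3.1 (i): ind-topological fields / torsion-cyclotomic ind-topological abelian monoids /
torsion-cyclotomic ind-locally compact abelian groups — owner abc-iut-L4-t2), `T⊚ := TF` if `T = TF`, else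
`TLG`. A global `T`-pair is a global Galois-theater together with "global arithmetic data" `M⊚ ∈ Ob(T⊚)` with
continuous `Π`-action, restriction morphisms `ρ_v`, MLF-Galois `T`-pairs `(Π_v ↷ M_v)` (Def 3.1 (ii)) at
nonarchimedean `v` and Aut-holomorphic `T`-pairs `(X_v ↶κ M_v)` (Def 4.1) at archimedean `v`, admitting reference
isomorphisms from the canonical data `M_{T⊚}(Π) = k_NF(Π)` / `k^×_NF(Π)`, `M_T(Π, v) = k_NF(Π,v)` / `k^×_NF(Π,v)` /
`𝒪^▷_{k_NF(Π,v)}`. ALL of `T`, `T⊚`, the MLF-Galois and Aut-holomorphic `T`-pairs and the canonical data are DEEP /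
FOREIGN inputs (abc-iut-L4-t2 Def 3.1, 4.1; abc-iut-L4-t1 Thm 1.9): they enter through ONE interface structure
`TPairVocabulary R` whose fields quote print — the categories as Mathlib categories, the actions as homomorphisms
into `Aut`, "continuity" and "is an MLF-Galois / Aut-holomorphic `T`-pair" as predicates (TODO-merge
abc-iut-L4-t2). Over it: `GlobalTPair` (Def 5.1 (v), local data indexed by `V̄ = V̄^non ∪ V̄^arc`, reference
conditions (a)–(d)) with morphisms ((a)–(d)), the cyclotomes of the `TM`-images with Cor 5.2 (ii)'s compatibility
predicate as a vocabulary field, `PanalocalTPairData` (Def 5.1 (vi), data level) with morphisms, the geometric-isomorphism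
subcategories `(−)[Z]` (Def 5.4 (i), predicate `IsGeomIsoTo z` indexed by a stub index type of `Z`'s), Cor 5.2 (ii)–(iv)
(`T ∈ {TF, TM}`) and Rmk 5.2.3 as named `Prop` facts (assumptions on `(R, W)`); Rmk 5.2.2 (`Th⊚ ≃ An⊚[Th⊚_T] ≃ Th⊚`) is a
gloss in the docstring of `TPairIsoCanonical` (referee L3-F3). Cor 5.2 (iii) is PARTIAL (RQ7 T1): its MAIN clause (the
functorial Kummer map `M⊚_TM ⥲ (M⊚_TM)^gp ⥲ M⊚_TLG ↪ lim→_J H¹(J, μ_Ẑ(M⊚_TM)) ⥲ lim→_J H¹(J, μ_Ẑ(Π))`, p. 119) is NOT typed.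

Modelling notes: `Orb(−)`/"[orbi-]" qualifiers affect morphisms only (representatives recorded); the canonical
global `T`-pair `M⊚_T(Π)` (Cor 5.2 (iv)) is the vocabulary's canonical data with identity reference isomorphisms. NOT
here: `⊠`/`⊞`-line bundles (`ArithmeticLineBundles.lean`), the log-Frobenius functors (`LogFrobeniusCompatibility.lean`).
Refereed pre-IUT anabelian geometry; nothing here bears on [IUTchIII] Cor. 3.12; typed ≠ discharged.
-/

set_option autoImplicit false

universe u

open CategoryTheory Topology

namespace Literature.AnabelianGeometry.AbsoluteAnabelian

/-- the type symbols `T ∈ {TF, TM, TLG}` of Def 5.1 (v). [cite: MochizukiAbsTopIII2015, Def 5.1 (v) p. 116] -/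
inductive TKind : Type
  | TF | TM | TLG
  deriving DecidableEq

/-- `T⊚ := T` if `T = TF`; `T⊚ := TLG` otherwise. [cite: MochizukiAbsTopIII2015, Def 5.1 (v) p. 116] -/
def TKind.glob : TKind → TKind
  | .TF => .TF | _ => .TLG

/-- INTERFACE (TODO-merge abc-iut-L4-t2 Def 3.1 / 4.1, abc-iut-L4-t1 Thm 1.9): the categories `T`, `T⊚` with
"continuous actions" of profinite groups on their objects, the predicates "is an MLF-Galois `T`-pair with Galois
group `D`" (Def 3.1 (ii)) and "is an Aut-holomorphic `T`-pair with structure-orbispace `X`" (Def 4.1), Kummer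
structures and their transport, the functor `(−)^{T⊚} : T → T⊚`, the canonical data `M_{T⊚}(Π)`, `M_T(Π, v)`
(`v ∈ V(Π) = V(Π)^non ∪ V(Π)^arc` — NOT at the generic element), `ρ_v(Π)` of Def 5.1 (v) "determined by `k_NF(Π)`
[if `T⊚ = TF`], `k^×_NF(Π)` [if `T⊚ = TLG`] … `k_NF(Π,v)`, `k^×_NF(Π,v)`, `𝒪^▷_{k_NF(Π,v)}` [if `T = TM`]", the cyclotomes
`μ_Ẑ(−) = Hom(ℚ/ℤ, −)` of the `TM`-images with the compatibility predicate of Cor 5.2 (ii), and the predicate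
"geometrically isomorphic to `Z`" of Def 5.4 (i) indexed by a stub index type of elliptically admissible `Z`.
[cite: MochizukiAbsTopIII2015, Def 5.1 (v) pp. 116–117] -/
structure TPairVocabulary (R : GlobalAnabelianContext.{u}) (T : TKind) : Type (u + 2) where
  /-- `Ob(T)` -/
  LocObj : Type (u + 1)
  [locCat : Category.{u} LocObj]
  /-- `Ob(T⊚)` -/
  GlobObj : Type (u + 1)
  [globCat : Category.{u} GlobObj]
  /-- `(−)^{T⊚} : T → T⊚` (groupification, or the identity) -/
  toGlob : LocObj ⥤ GlobObj
  /-- continuity of actions of profinite groups on objects of `T` / of `T⊚` -/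
  IsContLoc : ∀ {D : ProfiniteGrp.{u}} {M : LocObj}, (D →* Aut M) → Prop
  IsContGlob : ∀ {P : ProfiniteGrp.{u}} {M : GlobObj}, (P →* Aut M) → Prop
  /-- "`(D ↷ M)` is an MLF-Galois `T`-pair with Galois group `D`" (Def 3.1 (ii)) -/
  IsMLFGaloisPair : ∀ {D : ProfiniteGrp.{u}} {M : LocObj}, (D →* Aut M) → Prop
  /-- Kummer structures `X ↶κ M` on an object of `T` (Def 4.1) -/
  KummerStr : AutHolOrbispace.{u} → LocObj → Type u
  /-- "`(X ↶κ M)` is an Aut-holomorphic `T`-pair with structure-orbispace `X`" (Def 4.1) -/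
  IsAutHolPair : ∀ {X : AutHolOrbispace.{u}} {M : LocObj}, KummerStr X M → Prop
  /-- transport of Kummer structures along isomorphisms of Aut-holomorphic orbispaces and of `T`-objects -/
  kummerTransport : ∀ {X Y : AutHolOrbispace.{u}} {M N : LocObj}, AutHolOrbispace.Iso X Y → (M ≅ N) →
    KummerStr X M → KummerStr Y N
  /-- transport along identities is the identity -/
  kummerTransport_refl : ∀ {X : AutHolOrbispace.{u}} {M : LocObj} (k : KummerStr X M),
    kummerTransport ⟨Homeomorph.refl _, RingEquiv.refl _, ContinuousMulEquiv.refl _⟩ (Iso.refl M) k = k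
  /-- `M_{T⊚}(Π)`: "the object of `T⊚` determined by `k_NF(Π)` [`T⊚ = TF`], `k^×_NF(Π)` [`T⊚ = TLG`]" -/
  globData : FundamentalExtension.{u} → GlobObj
  /-- its continuous `Π`-action -/
  globAct : ∀ E : FundamentalExtension.{u}, (E.arith →* Aut (globData E))
  /-- `M_T(Π, v)`, `v ∈ V(Π)^non`: "determined by `k_NF(Π,v)` [`TF`], `k^×_NF(Π,v)` [`TLG`], `𝒪^▷_{k_NF(Π,v)}` [`TM`]" -/
  locDataNon : ∀ E : FundamentalExtension.{u}, (R.proVal E).non → LocObj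
  /-- `M_T(Π, v)`, `v ∈ V(Π)^arc` -/
  locDataArc : ∀ E : FundamentalExtension.{u}, (R.proVal E).arc → LocObj
  /-- the continuous action of the decomposition group `Π_v` on `M_T(Π, v)` (`v` nonarchimedean) -/
  locAct : ∀ (E : FundamentalExtension.{u}) (v : (R.proVal E).non),
    (R.proVal E).decompGrp (v : (R.proVal E).carrier) →* Aut (locDataNon E v)
  /-- the Kummer structure of `(X(Π,v) ↶κ M_T(Π,v))` at archimedean `v` -/
  locKummer : ∀ (E : FundamentalExtension.{u}) (v : (R.proVal E).arc), KummerStr (R.archSpace E v) (locDataArc E v)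
  /-- the natural restriction morphisms `ρ_v(Π) : M_{T⊚}(Π) → M_T(Π, v)^{T⊚}`, `v` nonarchimedean -/
  locRestrictNon : ∀ (E : FundamentalExtension.{u}) (v : (R.proVal E).non), globData E ⟶ toGlob.obj (locDataNon E v)
  /-- the natural restriction morphisms `ρ_v(Π)`, `v` archimedean -/
  locRestrictArc : ∀ (E : FundamentalExtension.{u}) (v : (R.proVal E).arc), globData E ⟶ toGlob.obj (locDataArc E v)
  /-- the cyclotome `μ_Ẑ(M_{TM}) := Hom(ℚ/ℤ, M_{TM})` of the `TM`-image of an object of `T⊚` (for `T = TF` via the natural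
  functor `Th_{TF} → Th_{TM}`), a profinite group `≅ Ẑ` -/
  cyclotome : GlobObj → ProfiniteGrp.{u}
  /-- the cyclotome `μ_Ẑ(Π)` of Thm 1.9 (b) (TODO-merge abc-iut-L4-t1) -/
  cyclotomeGrp : FundamentalExtension.{u} → ProfiniteGrp.{u}
  /-- Cor 5.2 (ii)'s compatibility: "an isomorphism `μ_Ẑ(M⊚_{TM}) ≅ μ_Ẑ(Π)` of `Π`-modules that is compatible — relative to
  the restriction morphisms `{ρ_v}_{v ∈ V̄^non}` — with the isomorphisms `μ_Ẑ((M_v)_{TM}) ≅ μ_Ẑ(Π_v)` of Cor 1.10 (c),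
  Rmk 3.2.1" (TODO-merge abc-iut-L4-t1/t2), as a predicate on a candidate isomorphism for given global data -/
  IsCyclotomeCompatible : ∀ {E : FundamentalExtension.{u}} {M : GlobObj}, (E.arith →* Aut M) →
    (cyclotome M ≃ₜ* cyclotomeGrp E) → Prop
  /-- Rmk 5.2.3's ARCHIMEDEAN compatibility (for `T = TLG`): `μ_Ẑ(M⊚) ≅ μ_Ẑ(Π)` related to the roots of unity of
  `A_{X_v}` through `κ_v` and the Kummer structure at the archimedean `v` (immune to the `{±1}`-indeterminacy of Prop 3.3 (i)) -/
  IsCyclotomeArchCompatible : ∀ {E : FundamentalExtension.{u}} {M : GlobObj}, (E.arith →* Aut M) →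
    (cyclotome M ≃ₜ* cyclotomeGrp E) → Prop
  /-- STUB index type of the elliptically admissible hyperbolic orbicurves `Z` over `ℚ̄` (TODO-merge abc-iut-L4-t4 / L5) -/
  ZIndex : Type u
  /-- "geometrically isomorphic to `Z`" (Def 5.4 (i)): `Π ≅ Π_X` with `X_F̄ ≅ Z` -/
  IsGeomIsoTo : ZIndex → FundamentalExtension.{u} → Prop

attribute [instance] TPairVocabulary.locCat TPairVocabulary.globCat

/-! ## Def 5.1 (v): global `T`-pairs -/

section

variable {R : GlobalAnabelianContext.{u}} {T : TKind} (W : TPairVocabulary R T)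

/-- Conditions (a)–(d) of Def 5.1 (v) on candidate reference isomorphisms `ψ⊚ : M_{T⊚}(Π) ≅ M⊚`, `ψ_v : M_T(Π,v) ≅ M_v`
over a reference isomorphism `ψ_V` of the underlying theater: (a) `ψ⊚` is `Π`-equivariant; (b) for `v ∈ V̄^non`, `ψ_v` is
`Π_v`-equivariant; (c) for `v ∈ V̄^arc`, `ψ_v` composed with the Kummer structure of `(X_v ↶κ M_v)` is compatible with `κ_v`
(through THE reference isomorphism `ψ_v : X(Π, v) ≅ X_v` of Def 5.1 (iii) (b): compatible with `δ`, `κ_v`); (d) `ψ⊚`, `{ψ_v}` are compatible with the `ρ_v` and `ρ_v(Π)`.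
[cite: MochizukiAbsTopIII2015, Def 5.1 (v) p. 117] -/
def IsTPairReferenceFor (T₀ : GlobalGaloisTheater R) (M : W.GlobObj) (act : T₀.grp →* Aut M)
    (Mnon : T₀.V.non → W.LocObj) (Marc : T₀.V.arc → W.LocObj)
    (actNon : ∀ v : T₀.V.non, T₀.V.decompGrp (v : T₀.V.carrier) →* Aut (Mnon v))
    (kummer : ∀ v : T₀.V.arc, W.KummerStr (T₀.X v) (Marc v))
    (ρnon : ∀ v : T₀.V.non, M ⟶ W.toGlob.obj (Mnon v)) (ρarc : ∀ v : T₀.V.arc, M ⟶ W.toGlob.obj (Marc v))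
    (ψV : (R.proVal T₀.ext).carrier ≃ₜ T₀.V.carrier)
    (hnon : ∀ v : (R.proVal T₀.ext).non, ψV v ∈ T₀.V.non) (harc : ∀ v : (R.proVal T₀.ext).arc, ψV v ∈ T₀.V.arc)
    (ψ : W.globData T₀.ext ≅ M)
    (ψnon : ∀ v : (R.proVal T₀.ext).non, W.locDataNon T₀.ext v ≅ Mnon ⟨ψV v, hnon v⟩)
    (ψarc : ∀ v : (R.proVal T₀.ext).arc, W.locDataArc T₀.ext v ≅ Marc ⟨ψV v, harc v⟩) : Prop :=
  (∀ g : T₀.grp, (W.globAct T₀.ext g).hom ≫ ψ.hom = ψ.hom ≫ (act g).hom) ∧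
  (∀ (v : (R.proVal T₀.ext).non) (g : T₀.grp) (hg : g ∈ (R.proVal T₀.ext).decomp (v : (R.proVal T₀.ext).carrier))
      (hg' : g ∈ T₀.V.decomp (ψV v)),
    (W.locAct T₀.ext v ⟨g, hg⟩).hom ≫ (ψnon v).hom = (ψnon v).hom ≫ (actNon ⟨ψV v, hnon v⟩ ⟨g, hg'⟩).hom) ∧
  (∀ v : (R.proVal T₀.ext).arc, ∃ ψv : AutHolOrbispace.Iso (R.archSpace T₀.ext v) (T₀.X ⟨ψV v, harc v⟩),
    InnerCompatible (fun a => ψv.pi1Iso (R.δell T₀.ext v a)) (T₀.δ ⟨ψV v, harc v⟩) id ∧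
    (∀ x : R.kNF T₀.ext, T₀.κ ⟨ψV v, harc v⟩ x = ψv.fieldIso (R.κell T₀.ext v x)) ∧
    W.kummerTransport ψv (ψarc v) (W.locKummer T₀.ext v) = kummer ⟨ψV v, harc v⟩) ∧
  (∀ v : (R.proVal T₀.ext).non,
    W.locRestrictNon T₀.ext v ≫ W.toGlob.map (ψnon v).hom = ψ.hom ≫ ρnon ⟨ψV v, hnon v⟩) ∧
  (∀ v : (R.proVal T₀.ext).arc,
    W.locRestrictArc T₀.ext v ≫ W.toGlob.map (ψarc v).hom = ψ.hom ≫ ρarc ⟨ψV v, harc v⟩)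

/-- A **global `T`-pair** `M⊚ = (V⊚, M⊚, {ρ_v}_{v ∈ V̄}, {(Π_v ↷ M_v)}_{v ∈ V̄^non}, {(X_v ↶κ M_v)}_{v ∈ V̄^arc})`
(`V̄ = V̄^non ∪ V̄^arc`): a global Galois-theater `V⊚`; global arithmetic data `M⊚ ∈ Ob(T⊚)` with continuous `Π`-action;
for `v ∈ V̄^non` an MLF-Galois `T`-pair with Galois group `Π_v`; for `v ∈ V̄^arc` an Aut-holomorphic `T`-pair with
structure-orbispace `X_v`; restriction morphisms `ρ_v : M⊚ → M_v^{T⊚}` (`v ∈ V̄`) — such that reference isomorphisms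
`ψ⊚`, `ψ_v` with (a)–(d) exist relative to a reference isomorphism `ψ_V` of `V⊚`.
[cite: MochizukiAbsTopIII2015, Def 5.1 (v) pp. 116–117] -/
structure GlobalTPair : Type (u + 1) where
  /-- the underlying global Galois-theater `V⊚` -/
  theater : GlobalGaloisTheater R
  /-- `M⊚ ∈ Ob(T⊚)` -/
  M : W.GlobObj
  /-- the action `Π ↷ M⊚` -/
  act : theater.grp →* Aut M
  /-- continuity of the action -/
  isCont : W.IsContGlob act
  /-- `M_v`, `v ∈ V̄^non` -/
  Mnon : theater.V.non → W.LocObj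
  /-- `M_v`, `v ∈ V̄^arc` -/
  Marc : theater.V.arc → W.LocObj
  /-- `Π_v ↷ M_v`, `v ∈ V̄^non` -/
  actNon : ∀ v : theater.V.non, theater.V.decompGrp (v : theater.V.carrier) →* Aut (Mnon v)
  /-- `(Π_v ↷ M_v)` is an MLF-Galois `T`-pair -/
  isMLF : ∀ v : theater.V.non, W.IsMLFGaloisPair (actNon v)
  /-- the Kummer structure `X_v ↶κ M_v`, `v ∈ V̄^arc` -/
  kummer : ∀ v : theater.V.arc, W.KummerStr (theater.X v) (Marc v)
  /-- `(X_v ↶κ M_v)` is an Aut-holomorphic `T`-pair -/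
  isAutHol : ∀ v : theater.V.arc, W.IsAutHolPair (kummer v)
  /-- `ρ_v : M⊚ → M_v^{T⊚}`, `v ∈ V̄^non` -/
  ρnon : ∀ v : theater.V.non, M ⟶ W.toGlob.obj (Mnon v)
  /-- `ρ_v : M⊚ → M_v^{T⊚}`, `v ∈ V̄^arc` -/
  ρarc : ∀ v : theater.V.arc, M ⟶ W.toGlob.obj (Marc v)
  /-- existence of reference isomorphisms `ψ_V`, `ψ⊚`, `ψ_v` with (a)–(d) -/
  exists_reference : ∃ (ψV : (R.proVal theater.ext).carrier ≃ₜ theater.V.carrier) (_ : theater.IsReferenceIso ψV)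
    (hnon : ∀ v : (R.proVal theater.ext).non, ψV v ∈ theater.V.non)
    (harc : ∀ v : (R.proVal theater.ext).arc, ψV v ∈ theater.V.arc)
    (ψ : W.globData theater.ext ≅ M)
    (ψnon : ∀ v : (R.proVal theater.ext).non, W.locDataNon theater.ext v ≅ Mnon ⟨ψV v, hnon v⟩)
    (ψarc : ∀ v : (R.proVal theater.ext).arc, W.locDataArc theater.ext v ≅ Marc ⟨ψV v, harc v⟩),
    IsTPairReferenceFor W theater M act Mnon Marc actNon kummer ρnon ρarc ψV hnon harc ψ ψnon ψarc

/-- A **morphism of global `T`-pairs**: a morphism of global Galois-theaters `φ_{V⊚}`, an isomorphism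
`φ⊚ : M⊚₁ ≅ M⊚₂` of `T⊚`, and isomorphisms `φ_v : (M₁)_{v₁} ≅ (M₂)_{v₂}` in `T`, with (a) `φ⊚` equivariant along
`Π₁ ↪ Π₂`, (b) `φ_{v₁}` compatible with the actions of `(Π₁)_{v₁}`, `(Π₂)_{v₂}` relative to the induced open injection,
(c) `φ_{v₁}` compatible with the Kummer structures relative to the isomorphism `(X₁)_{v₁} ≅ (X₂)_{v₂}` induced by
`φ_{V⊚}` (compatible with `δ`, `κ`), (d) compatibility with the `ρ`'s.
[cite: MochizukiAbsTopIII2015, Def 5.1 (v) p. 117] -/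
structure GlobalTPair.Hom (P₁ P₂ : GlobalTPair W) : Type u where
  /-- `φ_{V⊚}` -/
  φV : GlobalGaloisTheater.Hom P₁.theater P₂.theater
  /-- `φ⊚ : M⊚₁ ≅ M⊚₂` -/
  φM : P₁.M ≅ P₂.M
  /-- (a) equivariance along `Π₁ ↪ Π₂` -/
  φM_equivariant : ∀ g : P₁.theater.grp, (P₁.act g).hom ≫ φM.hom = φM.hom ≫ (P₂.act (φV.φgrp.arith g)).hom
  /-- (bookkeeping) `V̄^non₁ → V̄^non₂` -/
  non_mem : ∀ v : P₁.theater.V.non, φV.φV v ∈ P₂.theater.V.non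
  /-- (bookkeeping) `V̄^arc₁ → V̄^arc₂` -/
  arc_mem : ∀ v : P₁.theater.V.arc, φV.φV v ∈ P₂.theater.V.arc
  /-- `φ_v : (M₁)_{v₁} ≅ (M₂)_{v₂}`, `v₁` nonarchimedean -/
  φnon : ∀ v : P₁.theater.V.non, P₁.Mnon v ≅ P₂.Mnon ⟨φV.φV v, non_mem v⟩
  /-- (b) compatibility with the actions relative to `(Π₁)_{v₁} ↪ (Π₂)_{v₂}` -/
  φnon_equivariant : ∀ (v : P₁.theater.V.non) (g : P₁.theater.grp)
      (hg : g ∈ P₁.theater.V.decomp (v : P₁.theater.V.carrier))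
      (hg' : φV.φgrp.arith g ∈ P₂.theater.V.decomp (φV.φV v)),
    (P₁.actNon v ⟨g, hg⟩).hom ≫ (φnon v).hom =
      (φnon v).hom ≫ (P₂.actNon ⟨φV.φV v, non_mem v⟩ ⟨φV.φgrp.arith g, hg'⟩).hom
  /-- `φ_v : (M₁)_{v₁} ≅ (M₂)_{v₂}`, `v₁` archimedean -/
  φarc : ∀ v : P₁.theater.V.arc, P₁.Marc v ≅ P₂.Marc ⟨φV.φV v, arc_mem v⟩
  /-- (c) compatibility with the Kummer structures relative to `(X₁)_{v₁} ≅ (X₂)_{v₂}` -/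
  φarc_kummer : ∀ v : P₁.theater.V.arc, ∃ φv : AutHolOrbispace.Iso (P₁.theater.X v) (P₂.theater.X ⟨φV.φV v, arc_mem v⟩),
    InnerCompatible (fun a : P₁.theater.ext.geom => φv.pi1Iso (P₁.theater.δ v a))
      (P₂.theater.δ ⟨φV.φV v, arc_mem v⟩) (fun a => ⟨φV.φgrp.arith a, φV.isEAHom.bijOn_geom.mapsTo a.2⟩) ∧
    (∀ x : R.kNF P₁.theater.ext, P₂.theater.κ ⟨φV.φV v, arc_mem v⟩ (R.mapKNF φV.φgrp φV.isEAHom x) =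
      φv.fieldIso (P₁.theater.κ v x)) ∧
    W.kummerTransport φv (φarc v) (P₁.kummer v) = P₂.kummer ⟨φV.φV v, arc_mem v⟩
  /-- (d) compatibility with `ρ`, nonarchimedean -/
  ρnon_comm : ∀ v : P₁.theater.V.non,
    P₁.ρnon v ≫ W.toGlob.map (φnon v).hom = φM.hom ≫ P₂.ρnon ⟨φV.φV v, non_mem v⟩
  /-- (d) compatibility with `ρ`, archimedean -/
  ρarc_comm : ∀ v : P₁.theater.V.arc,
    P₁.ρarc v ≫ W.toGlob.map (φarc v).hom = φM.hom ≫ P₂.ρarc ⟨φV.φV v, arc_mem v⟩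

end

/-! ## Def 5.1 (vi): panalocal `T`-pairs -/

/-- The DATA of a **panalocal `T`-pair** `M✠ = (V✠, {(Π_v ↷ M_v)}_{v ∈ V^non}, {(X_v ↶κ M_v)}_{v ∈ V^arc})`: local `T`-pair
data indexed by abstract index sets `V^non`, `V^arc` with groups / orbispaces, WITHOUT the condition that these form a
panalocal Galois-theater (Def 5.1 (iv); that condition lives in `PanalocalTheaters.lean` — hence the name `…Data`);
no global datum, no restriction morphisms. [cite: MochizukiAbsTopIII2015, Def 5.1 (vi) p. 118] -/
structure PanalocalTPairData {R : GlobalAnabelianContext.{u}} {T : TKind} (W : TPairVocabulary R T)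
    (Vnon Varc : Type u) (D : Vnon → ProfiniteGrp.{u}) (X : Varc → AutHolOrbispace.{u}) : Type (u + 1) where
  /-- `M_v`, `v ∈ V^non` -/
  Mnon : Vnon → W.LocObj
  actNon : ∀ v, D v →* Aut (Mnon v)
  isMLF : ∀ v, W.IsMLFGaloisPair (actNon v)
  /-- `M_v`, `v ∈ V^arc`, with `X_v ↶κ M_v` -/
  Marc : Varc → W.LocObj
  kummer : ∀ v, W.KummerStr (X v) (Marc v)
  isAutHol : ∀ v, W.IsAutHolPair (kummer v)

/-- A **morphism of panalocal `T`-pair data**: bijections of the index sets, open injections `(Π₁)_{v₁} ↪ (Π₂)_{v₂}`,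
isomorphisms `(X₁)_{v₁} ≅ (X₂)_{v₂}`, and compatible `T`-isomorphisms of the [orbi-]MLF-Galois and Aut-holomorphic
`T`-pairs. [cite: MochizukiAbsTopIII2015, Def 5.1 (vi) p. 118] -/
structure PanalocalTPairData.Hom {R : GlobalAnabelianContext.{u}} {T : TKind} {W : TPairVocabulary R T}
    {V₁n V₁a V₂n V₂a : Type u} {D₁ : V₁n → ProfiniteGrp.{u}} {X₁ : V₁a → AutHolOrbispace.{u}}
    {D₂ : V₂n → ProfiniteGrp.{u}} {X₂ : V₂a → AutHolOrbispace.{u}}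
    (P₁ : PanalocalTPairData W V₁n V₁a D₁ X₁) (P₂ : PanalocalTPairData W V₂n V₂a D₂ X₂) : Type u where
  /-- `V^non₁ ≅ V^non₂` -/
  eNon : V₁n ≃ V₂n
  /-- `V^arc₁ ≅ V^arc₂` -/
  eArc : V₁a ≃ V₂a
  /-- `(Π₁)_{v} ↪ (Π₂)_{v'}` -/
  grpHom : ∀ v, D₁ v →ₜ* D₂ (eNon v)
  /-- an open injection -/
  grpHom_isOpenInjection : ∀ v, IsOpenInjection (grpHom v)
  /-- `(X₁)_v ≅ (X₂)_{v'}` -/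
  xIso : ∀ v, AutHolOrbispace.Iso (X₁ v) (X₂ (eArc v))
  /-- the `T`-isomorphisms at nonarchimedean indices -/
  φnon : ∀ v, P₁.Mnon v ≅ P₂.Mnon (eNon v)
  /-- compatible with the actions -/
  φnon_equivariant : ∀ v (g : D₁ v),
    (P₁.actNon v g).hom ≫ (φnon v).hom = (φnon v).hom ≫ (P₂.actNon (eNon v) (grpHom v g)).hom
  /-- the `T`-isomorphisms at archimedean indices -/
  φarc : ∀ v, P₁.Marc v ≅ P₂.Marc (eArc v)
  /-- compatible with the Kummer structures -/
  φarc_kummer : ∀ v, W.kummerTransport (xIso v) (φarc v) (P₁.kummer v) = P₂.kummer (eArc v)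

/-- the **panalocalization** `Th⊚_T → Th✠_T` on objects, at the level of local data: forget `M⊚` and the `ρ_v` (indexed by
`V̄^non`, `V̄^arc`; the passage to `V̄/Aut(Π)` is that of `PanalocalTheaters.lean`). [cite: MochizukiAbsTopIII2015, Def 5.1 (vi) p. 118] -/
def GlobalTPair.panalocalData {R : GlobalAnabelianContext.{u}} {T : TKind} {W : TPairVocabulary R T}
    (P : GlobalTPair W) :
    PanalocalTPairData W P.theater.V.non P.theater.V.arc
      (fun v => P.theater.V.decompGrp (v : P.theater.V.carrier)) P.theater.X where
  Mnon := P.Mnon; actNon := P.actNon; isMLF := P.isMLF; Marc := P.Marc; kummer := P.kummer; isAutHol := P.isAutHol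

/-! ## Cor 5.2 (ii)–(iv), Rmk 5.2.2, 5.2.3; Def 5.4 (i) -/

section

variable {R : GlobalAnabelianContext.{u}} {T : TKind} (W : TPairVocabulary R T)

/-- **Cor 5.2 (ii)** (named fact; `T ∈ {TF, TM}`; an assumption on `(R, W)` true for the genuine context): for a global
`T`-pair there is a UNIQUE isomorphism `μ_Ẑ(M⊚_{TM}) ≅ μ_Ẑ(Π)` of `Π`-modules compatible, relative to the `ρ_v`
(`v ∈ V̄^non`), with the local isomorphisms `μ_Ẑ((M_v)_{TM}) ≅ μ_Ẑ(Π_v)` of Cor 1.10 (c) / Rmk 3.2.1 (the compatibility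
being the vocabulary's `IsCyclotomeCompatible`). [cite: MochizukiAbsTopIII2015, Cor 5.2 (ii) p. 119] -/
def CyclotomeIsoUnique (_hT : T ≠ .TLG) : Prop :=
  ∀ P : GlobalTPair W, ∃! ι : W.cyclotome P.M ≃ₜ* W.cyclotomeGrp P.theater.ext, W.IsCyclotomeCompatible P.act ι

/-- **Cor 5.2 (iii), first half** (named fact; `T ∈ {TF, TM}`; assumption on `(R, W)`): the reference isomorphisms
`ψ⊚`, `{ψ_v}` of a global `T`-pair are uniquely determined, given the (unique, Rmk 5.1.1) `ψ_V`.
[cite: MochizukiAbsTopIII2015, Cor 5.2 (iii) p. 119] -/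
def ReferencePairIsoUnique (_hT : T ≠ .TLG) : Prop :=
  ∀ (P : GlobalTPair W) (ψV : (R.proVal P.theater.ext).carrier ≃ₜ P.theater.V.carrier),
    P.theater.IsReferenceIso ψV → ∀
    (hnon : ∀ v : (R.proVal P.theater.ext).non, ψV v ∈ P.theater.V.non)
    (harc : ∀ v : (R.proVal P.theater.ext).arc, ψV v ∈ P.theater.V.arc)
    (ψ ψ' : W.globData P.theater.ext ≅ P.M)
    (ψnon ψnon' : ∀ v : (R.proVal P.theater.ext).non, W.locDataNon P.theater.ext v ≅ P.Mnon ⟨ψV v, hnon v⟩)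
    (ψarc ψarc' : ∀ v : (R.proVal P.theater.ext).arc, W.locDataArc P.theater.ext v ≅ P.Marc ⟨ψV v, harc v⟩),
    IsTPairReferenceFor W P.theater P.M P.act P.Mnon P.Marc P.actNon P.kummer P.ρnon P.ρarc ψV hnon harc ψ ψnon ψarc →
    IsTPairReferenceFor W P.theater P.M P.act P.Mnon P.Marc P.actNon P.kummer P.ρnon P.ρarc ψV hnon harc ψ' ψnon' ψarc' →
    ψ = ψ' ∧ ψnon = ψnon' ∧ ψarc = ψarc'

/-- **Cor 5.2 (iii), second half** (named fact; `T ∈ {TF, TM}`; assumption on `(R, W)`): in a morphism of global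
`T`-pairs, `φ⊚` AND `{φ_v}` are uniquely determined by `φ_{V⊚}`. [cite: MochizukiAbsTopIII2015, Cor 5.2 (iii) p. 119] -/
def TPairHomDeterminedByTheaterHom (_hT : T ≠ .TLG) : Prop :=
  ∀ (P₁ P₂ : GlobalTPair W) (φ φ' : GlobalTPair.Hom W P₁ P₂), φ.φV = φ'.φV →
    φ.φM = φ'.φM ∧ HEq φ.φnon φ'.φnon ∧ HEq φ.φarc φ'.φarc

/-- the **canonical global `T`-pair** `M⊚_T(Π) := (V⊚(Π), M_{T⊚}(Π), {ρ_v(Π)}, {(Π_v ↷ M_T(Π,v))}, {(X(Π,v) ↶κ M_T(Π,v))})`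
(Cor 5.2 (iv), object map of `EA⊚ → An⊚[Th⊚_T]`; reference isomorphisms = identities), given that the canonical data
satisfy the vocabulary's own predicates. [cite: MochizukiAbsTopIII2015, Cor 5.2 (iv) pp. 119–120] -/
def TPairVocabulary.canonical (E : FundamentalExtension.{u}) (hE : R.IsAdmissible E)
    (hcont : W.IsContGlob (W.globAct E)) (hMLF : ∀ v : (R.proVal E).non, W.IsMLFGaloisPair (W.locAct E v))
    (hAH : ∀ v : (R.proVal E).arc, W.IsAutHolPair (W.locKummer E v)) : GlobalTPair W where
  theater := R.theater E hE
  M := W.globData E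
  act := W.globAct E
  isCont := hcont
  Mnon := W.locDataNon E; Marc := W.locDataArc E; actNon := W.locAct E; isMLF := hMLF
  kummer := W.locKummer E; isAutHol := hAH; ρnon := W.locRestrictNon E; ρarc := W.locRestrictArc E
  exists_reference := ⟨Homeomorph.refl _, R.refl_isReferenceIsoFor E, fun v => v.2, fun v => v.2, Iso.refl _,
    fun _ => Iso.refl _, fun _ => Iso.refl _,
    fun g => by
      change ((W.globAct E) g).hom ≫ 𝟙 _ = 𝟙 _ ≫ ((W.globAct E) g).hom
      rw [Category.comp_id, Category.id_comp],
    fun v g hg hg' => by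
      change (W.locAct E v ⟨g, hg⟩).hom ≫ 𝟙 _ = 𝟙 _ ≫ (W.locAct E v ⟨g, hg'⟩).hom
      rw [Category.comp_id, Category.id_comp],
    fun v => ⟨⟨Homeomorph.refl _, RingEquiv.refl _, ContinuousMulEquiv.refl _⟩,
      ⟨1, fun a => by simp only [one_mul, inv_one, mul_one]; rfl⟩, fun _ => rfl, W.kummerTransport_refl _⟩,
    fun v => by
      change W.locRestrictNon E v ≫ W.toGlob.map (𝟙 (W.locDataNon E v)) = 𝟙 _ ≫ W.locRestrictNon E v
      rw [CategoryTheory.Functor.map_id, Category.comp_id, Category.id_comp],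
    fun v => by
      change W.locRestrictArc E v ≫ W.toGlob.map (𝟙 (W.locDataArc E v)) = 𝟙 _ ≫ W.locRestrictArc E v
      rw [CategoryTheory.Functor.map_id, Category.comp_id, Category.id_comp]⟩

/-- **Cor 5.2 (iv), essential surjectivity** (named fact; `T ∈ {TF, TM}`; assumption on `(R, W)`): every global `T`-pair
is isomorphic over `𝟙 Π` to the canonical one (Rmk 5.2.2: hence `Th⊚ ≃ An⊚[Th⊚_T] ≃ Th⊚`). [cite: MochizukiAbsTopIII2015, Cor 5.2 (iv) p. 120] -/
def TPairIsoCanonical (_hT : T ≠ .TLG) : Prop :=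
  ∀ P : GlobalTPair W, ∃ (hc : W.IsContGlob (W.globAct P.theater.ext))
    (hM : ∀ v : (R.proVal P.theater.ext).non, W.IsMLFGaloisPair (W.locAct P.theater.ext v))
    (hA : ∀ v : (R.proVal P.theater.ext).arc, W.IsAutHolPair (W.locKummer P.theater.ext v)),
    ∃ φ : GlobalTPair.Hom W (W.canonical P.theater.ext P.theater.isAdmissible hc hM hA) P, φ.φV.φgrp = 𝟙 _

/-- **Cor 5.2 (iv), full faithfulness** (named fact; `T ∈ {TF, TM}`; assumption on `(R, W)`): every morphism of `EA⊚`
between admissible `Π₁, Π₂` extends to a morphism of the canonical global `T`-pairs (uniquely, by Cor 5.2 (iii)).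
[cite: MochizukiAbsTopIII2015, Cor 5.2 (iv) p. 120] -/
def TPairEAHomExtends (_hT : T ≠ .TLG) : Prop :=
  ∀ (E₁ E₂ : FundamentalExtension.{u}) (h₁ : R.IsAdmissible E₁) (h₂ : R.IsAdmissible E₂)
    (hc₁ : W.IsContGlob (W.globAct E₁)) (hM₁ : ∀ v, W.IsMLFGaloisPair (W.locAct E₁ v))
    (hA₁ : ∀ v, W.IsAutHolPair (W.locKummer E₁ v))
    (hc₂ : W.IsContGlob (W.globAct E₂)) (hM₂ : ∀ v, W.IsMLFGaloisPair (W.locAct E₂ v))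
    (hA₂ : ∀ v, W.IsAutHolPair (W.locKummer E₂ v)) (f : E₁ ⟶ E₂), IsEAHom f →
    ∃ φ : GlobalTPair.Hom W (W.canonical E₁ h₁ hc₁ hM₁ hA₁) (W.canonical E₂ h₂ hc₂ hM₂ hA₂), φ.φV.φgrp = f

/-- **Rmk 5.2.3** (remark-level claim, `T = TLG`; assumption on `(R, W)`): "a similar result to Cor 5.2 (ii) may be
obtained when `T = TLG` by using the archimedean primes, which are immune to the `{±1}`-indeterminacy of Prop 3.3 (i)" —
typed as the existence of a compatible cyclotome isomorphism for every global `TLG`-pair with an archimedean place.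
[cite: MochizukiAbsTopIII2015, Rmk 5.2.3 pp. 121–122] -/
def CyclotomeIsoViaArchimedean (_hT : T = .TLG) : Prop :=
  ∀ P : GlobalTPair W, (P.theater.V.arc).Nonempty →
    ∃ ι : W.cyclotome P.M ≃ₜ* W.cyclotomeGrp P.theater.ext, W.IsCyclotomeArchCompatible P.act ι

/-- **Def 5.4 (i)**: the full subcategories `EA⊚[Z] ⊆ EA⊚`, `Th•[Z]`, `Th•_T[Z]` determined by the profinite groups
isomorphic to `Π_X` with `X` *geometrically isomorphic* to `Z` (`X_F̄ ≅ Z`); on them "the set `V̄/Aut(Π)` has a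
meaning independent of the choice of object" — as the predicate on global `T`-pairs, indexed by `Z`.
[cite: MochizukiAbsTopIII2015, Def 5.4 (i) pp. 124–125] -/
def GlobalTPair.IsGeomIsoTo (z : W.ZIndex) (P : GlobalTPair W) : Prop := W.IsGeomIsoTo z P.theater.ext

end

end Literature.AnabelianGeometry.AbsoluteAnabelian
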